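import Literature.Probability.RandomPlanarGeometry.SAWCount

/-!
# Line `kesten-product-renewal-dictionary` for the crux `SAWTotalPositivity.CriticalBubbleBound`
(stmt-CriticalPhenomena-7117): strip-gap stub T1 `detour_count` — the boundary-detour injection

The "Case 1" input of the inductive step of the strip gap `μ(strip of width w) < μ(ℤ²)`: `n`-step
self-avoiding walks all of whose columns are `≤ R` and which make at least `m` vertical steps of a
fixed time-parity `p` inside the column `R` are few compared with `c_{n+2j}`,

  `#{ω ∈ saws 2 n : (∀ i ≤ n, ω i 0 ≤ R), m ≤ #V(ω)} · (m choose j) ≤ c_{n+2j}`,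

where `V(ω) = {t < n : t % 2 = p, ω t 0 = R, ω (t+1) 0 = R}`. Proof: for a `j`-subset `T ⊆ V(ω)`
insert at every `t ∈ T` the detour `ω t → ω t + e₀ → ω (t+1) + e₀ → ω (t+1)` into the free column
`R + 1` (iterating single insertions from the largest time downwards, `List.foldr` over the sorted
list of `T`); the result is an `(n+2j)`-step self-avoiding walk (the new vertices lie in column `R+1`,
and are pairwise distinct because two distinct times of `T` have the same parity, hence differ by at
least `2`), and `(ω, T) ↦ ω^T` is injective (the first detour is detected as the first visit to column
`R + 1`, and a single insertion is injective). Counting with `Finset.card_sigma`,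
`Finset.card_powersetCard` and `Finset.card_le_card_of_injOn` gives the bound.

Source: N. Madras, G. Slade, *The Self-Avoiding Walk* (1993), §7.2–§8.1 (strip/boundary surgery; folklore).
-/

noncomputable section

open Literature.Probability.LatticeModels
open Literature.Probability.RandomPlanarGeometry Literature.Probability.RandomPlanarGeometry.SAW
open scoped ENNReal NNReal BigOperators

namespace Summit.CriticalPhenomena.SAWScalingLimit.Theorems.CriticalBubbleBound.Kesten.Strip

/-! ## The single detour insertion `ins t W` (given by a defining hypothesis `hins`) -/

/-- The detour insertion does not move times `≤ t`. [folklore] -/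
theorem ins_of_le {E : Site 2} {ins : ℕ → (ℕ → Site 2) → ℕ → Site 2}
    (hins : ∀ t W s, ins t W s =
      if s ≤ t then W s else if s = t + 1 then W t + E else if s = t + 2 then W (t + 1) + E else W (s - 2))
    {t s : ℕ} (W : ℕ → Site 2) (hs : s ≤ t) : ins t W s = W s := by
  rw [hins, if_pos hs]

/-- The first new vertex of the detour insertion. [folklore] -/
theorem ins_succ {E : Site 2} {ins : ℕ → (ℕ → Site 2) → ℕ → Site 2}
    (hins : ∀ t W s, ins t W s =
      if s ≤ t then W s else if s = t + 1 then W t + E else if s = t + 2 then W (t + 1) + E else W (s - 2))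
    (t : ℕ) (W : ℕ → Site 2) : ins t W (t + 1) = W t + E := by
  rw [hins, if_neg (by omega), if_pos rfl]

/-- The second new vertex of the detour insertion. [folklore] -/
theorem ins_add_two {E : Site 2} {ins : ℕ → (ℕ → Site 2) → ℕ → Site 2}
    (hins : ∀ t W s, ins t W s =
      if s ≤ t then W s else if s = t + 1 then W t + E else if s = t + 2 then W (t + 1) + E else W (s - 2))
    (t : ℕ) (W : ℕ → Site 2) : ins t W (t + 2) = W (t + 1) + E := by
  rw [hins, if_neg (by omega), if_neg (by omega), if_pos rfl]

/-- After the detour, the insertion is the old walk shifted by two time units. [folklore] -/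
theorem ins_of_gt {E : Site 2} {ins : ℕ → (ℕ → Site 2) → ℕ → Site 2}
    (hins : ∀ t W s, ins t W s =
      if s ≤ t then W s else if s = t + 1 then W t + E else if s = t + 2 then W (t + 1) + E else W (s - 2))
    {t s : ℕ} (W : ℕ → Site 2) (hs : t + 2 < s) : ins t W s = W (s - 2) := by
  rw [hins, if_neg (by omega), if_neg (by omega), if_neg (by omega)]

/-- **One detour.** If `W` is an `N`-step self-avoiding walk, `t < N`, and the two translates
`W t + E`, `W (t+1) + E` (by a lattice unit vector `E`) are not visited by `W`, then inserting the detour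
`W t → W t + E → W (t+1) + E → W (t+1)` gives an `(N+2)`-step self-avoiding walk. [folklore] -/
theorem ins_mem_saws {E : Site 2} (hE : ∀ x : Site 2, (zdGraph 2).Adj x (x + E))
    {ins : ℕ → (ℕ → Site 2) → ℕ → Site 2}
    (hins : ∀ t W s, ins t W s =
      if s ≤ t then W s else if s = t + 1 then W t + E else if s = t + 2 then W (t + 1) + E else W (s - 2))
    {N t : ℕ} {W : ℕ → Site 2} (hW : W ∈ Zd.saws 2 N) (ht : t < N)
    (h1 : ∀ s, W s ≠ W t + E) (h2 : ∀ s, W s ≠ W (t + 1) + E) :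
    ins t W ∈ Zd.saws 2 (N + 2) := by
  rw [Zd.mem_saws] at hW ⊢
  obtain ⟨h0, hend, hadj, hinj⟩ := hW
  refine ⟨by rw [ins_of_le hins W (Nat.zero_le t), h0], fun i hi => ?_, fun i hi => ?_, ?_⟩
  · -- frozen after `N + 2`
    rw [ins_of_gt hins W (show t + 2 < i by omega), ins_of_gt hins W (show t + 2 < N + 2 by omega),
      hend (i - 2) (by omega), Nat.add_sub_cancel]
  · -- nearest-neighbour steps
    rcases Nat.lt_or_ge i t with h | h
    · rw [ins_of_le hins W h.le, ins_of_le hins W (Nat.succ_le_of_lt h)]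
      exact hadj i (by omega)
    rcases Nat.lt_or_ge (t + 2) i with h' | h'
    · rw [ins_of_gt hins W h', ins_of_gt hins W (show t + 2 < i + 1 by omega),
        show i + 1 - 2 = i - 2 + 1 by omega]
      exact hadj (i - 2) (by omega)
    obtain rfl | rfl | rfl : i = t ∨ i = t + 1 ∨ i = t + 2 := by omega
    · rw [ins_of_le hins W le_rfl, ins_succ hins]
      exact hE _
    · rw [ins_succ hins, show t + 1 + 1 = t + 2 from rfl, ins_add_two hins]
      exact (Zd.zdGraph_adj_add_right _ _ _).2 (hadj t ht)
    · rw [ins_add_two hins, ins_of_gt hins W (show t + 2 < t + 2 + 1 by omega),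
        show t + 2 + 1 - 2 = t + 1 by omega]
      exact (hE _).symm
  · -- self-avoidance
    have hcl : ∀ i, (∃ k, ins t W i = W k ∧ (k ≤ t ∧ i = k ∨ t < k ∧ i = k + 2)) ∨
        (i = t + 1 ∧ ins t W i = W t + E) ∨ (i = t + 2 ∧ ins t W i = W (t + 1) + E) := by
      intro i
      rcases le_or_gt i t with h | h
      · exact Or.inl ⟨i, ins_of_le hins W h, Or.inl ⟨h, rfl⟩⟩
      rcases le_or_gt i (t + 2) with h' | h'
      · obtain rfl | rfl : i = t + 1 ∨ i = t + 2 := by omega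
        · exact Or.inr (Or.inl ⟨rfl, ins_succ hins t W⟩)
        · exact Or.inr (Or.inr ⟨rfl, ins_add_two hins t W⟩)
      · exact Or.inl ⟨i - 2, ins_of_gt hins W h', Or.inr ⟨by omega, by omega⟩⟩
    intro i hi j hj hij
    simp only [Set.mem_setOf_eq] at hi hj
    rcases hcl i with ⟨k, hk, hik⟩ | ⟨rfl, hk⟩ | ⟨rfl, hk⟩ <;>
      rcases hcl j with ⟨k', hk', hjk⟩ | ⟨rfl, hk'⟩ | ⟨rfl, hk'⟩ <;>
      simp only [hk, hk'] at hij
    · have := hinj (show k ∈ {i | i ≤ N} by simp only [Set.mem_setOf_eq]; omega)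
        (show k' ∈ {i | i ≤ N} by simp only [Set.mem_setOf_eq]; omega) hij
      omega
    · exact (h1 k hij).elim
    · exact (h2 k hij).elim
    · exact (h1 k' hij.symm).elim
    · rfl
    · have := hinj (show t ∈ {i | i ≤ N} by simp only [Set.mem_setOf_eq]; omega)
        (show t + 1 ∈ {i | i ≤ N} by simp only [Set.mem_setOf_eq]; omega) (add_right_cancel hij)
      omega
    · exact (h2 k' hij.symm).elim
    · have := hinj (show t + 1 ∈ {i | i ≤ N} by simp only [Set.mem_setOf_eq]; omega)
        (show t ∈ {i | i ≤ N} by simp only [Set.mem_setOf_eq]; omega) (add_right_cancel hij)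
      omega
    · rfl

/-! ## Iterated detours `L.foldr ins ω` along a decreasing sequence of insertion times -/

/-- **Invariant of the iterated insertion.** For an `n`-step self-avoiding walk `ω` with all columns
`≤ R` and a strictly increasing list `L` of times of vertical steps of `ω` inside the column `R`, all of
the same parity, the walk `L.foldr ins ω` (detours inserted from the largest time downwards) is an
`(n + 2|L|)`-step self-avoiding walk, agrees with `ω` up to the smallest insertion time, and visits only
old vertices `ω i`, `i ≤ n`, and the new vertices `ω t + E`, `ω (t+1) + E`, `t ∈ L`. [folklore] -/
theorem foldr_spec {E : Site 2} (hE : ∀ x : Site 2, (zdGraph 2).Adj x (x + E))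
    (hE0 : ∀ x : Site 2, (x + E) 0 = x 0 + 1)
    {ins : ℕ → (ℕ → Site 2) → ℕ → Site 2}
    (hins : ∀ t W s, ins t W s =
      if s ≤ t then W s else if s = t + 1 then W t + E else if s = t + 2 then W (t + 1) + E else W (s - 2))
    {n p : ℕ} {R : ℤ} {ω : ℕ → Site 2} (hω : ω ∈ Zd.saws 2 n) (hR : ∀ i ≤ n, ω i 0 ≤ R) :
    ∀ L : List ℕ, L.Pairwise (· < ·) →
      (∀ t ∈ L, t < n ∧ t % 2 = p ∧ ω t 0 = R ∧ ω (t + 1) 0 = R) →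
      L.foldr ins ω ∈ Zd.saws 2 (n + 2 * L.length) ∧
      (∀ s, (∀ t ∈ L, s ≤ t) → L.foldr ins ω s = ω s) ∧
      (∀ s, (∃ i ≤ n, L.foldr ins ω s = ω i) ∨
        ∃ t ∈ L, L.foldr ins ω s = ω t + E ∨ L.foldr ins ω s = ω (t + 1) + E) := by
  have hend := (Zd.mem_saws.1 hω).2.1
  have hinj := (Zd.mem_saws.1 hω).2.2.2
  intro L
  induction L with
  | nil =>
    intro _ _
    refine ⟨by simpa using hω, fun s _ => rfl, fun s => Or.inl ?_⟩
    rcases le_or_gt s n with hs | hs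
    · exact ⟨s, hs, rfl⟩
    · exact ⟨n, le_rfl, hend s hs.le⟩
  | cons t L ih =>
    intro hsort hmem
    rw [List.pairwise_cons] at hsort
    obtain ⟨hlt, hsort⟩ := hsort
    obtain ⟨htn, htp, ht0, ht1⟩ := hmem t List.mem_cons_self
    have hmemL : ∀ u ∈ L, u < n ∧ u % 2 = p ∧ ω u 0 = R ∧ ω (u + 1) 0 = R := fun u hu =>
      hmem u (List.mem_cons_of_mem t hu)
    obtain ⟨hW1, hW2, hW3⟩ := ih hsort hmemL
    simp only [List.foldr_cons, List.length_cons]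
    set W := L.foldr ins ω with hWdef
    have hWt : W t = ω t := hW2 t fun u hu => (hlt u hu).le
    have hWt1 : W (t + 1) = ω (t + 1) := hW2 (t + 1) fun u hu => hlt u hu
    -- the two new vertices are fresh
    have hfresh : ∀ s, W s ≠ ω t + E ∧ W s ≠ ω (t + 1) + E := by
      intro s
      rcases hW3 s with ⟨i, hi, his⟩ | ⟨u, hu, his⟩
      · rw [his]
        have := hR i hi
        refine ⟨fun h => ?_, fun h => ?_⟩
        · have h' := congrFun h 0
          rw [hE0] at h'
          omega
        · have h' := congrFun h 0
          rw [hE0] at h'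
          omega
      · obtain ⟨hun, hup, -, -⟩ := hmemL u hu
        have htu := hlt u hu
        rcases his with his | his <;> rw [his] <;> refine ⟨fun h => ?_, fun h => ?_⟩
        · have := hinj (show u ∈ {i | i ≤ n} by simp only [Set.mem_setOf_eq]; omega)
            (show t ∈ {i | i ≤ n} by simp only [Set.mem_setOf_eq]; omega) (add_right_cancel h)
          omega
        · have := hinj (show u ∈ {i | i ≤ n} by simp only [Set.mem_setOf_eq]; omega)
            (show t + 1 ∈ {i | i ≤ n} by simp only [Set.mem_setOf_eq]; omega) (add_right_cancel h)
          omega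
        · have := hinj (show u + 1 ∈ {i | i ≤ n} by simp only [Set.mem_setOf_eq]; omega)
            (show t ∈ {i | i ≤ n} by simp only [Set.mem_setOf_eq]; omega) (add_right_cancel h)
          omega
        · have := hinj (show u + 1 ∈ {i | i ≤ n} by simp only [Set.mem_setOf_eq]; omega)
            (show t + 1 ∈ {i | i ≤ n} by simp only [Set.mem_setOf_eq]; omega) (add_right_cancel h)
          omega
    refine ⟨?_, fun s hs => ?_, ?_⟩
    · -- an `(n + 2|L| + 2)`-step self-avoiding walk
      rw [show n + 2 * (L.length + 1) = n + 2 * L.length + 2 by ring]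
      refine ins_mem_saws hE hins hW1 (by omega) (fun s => ?_) (fun s => ?_)
      · rw [hWt]; exact (hfresh s).1
      · rw [hWt1]; exact (hfresh s).2
    · -- agreement with `ω` below the insertion times
      rw [ins_of_le hins W (hs t List.mem_cons_self)]
      exact hW2 s fun u hu => hs u (List.mem_cons_of_mem t hu)
    · -- the visited vertices
      have lift : ∀ u, (∃ i ≤ n, W u = ω i) ∨
          ∃ t' ∈ t :: L, W u = ω t' + E ∨ W u = ω (t' + 1) + E := fun u =>
        (hW3 u).imp_right fun ⟨t', ht', h⟩ => ⟨t', List.mem_cons_of_mem t ht', h⟩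
      intro s
      rcases le_or_gt s t with h | h
      · rw [ins_of_le hins W h]; exact lift s
      rcases le_or_gt s (t + 2) with h' | h'
      · obtain rfl | rfl : s = t + 1 ∨ s = t + 2 := by omega
        · exact Or.inr ⟨t, List.mem_cons_self, Or.inl (by rw [ins_succ hins, hWt])⟩
        · exact Or.inr ⟨t, List.mem_cons_self, Or.inr (by rw [ins_add_two hins, hWt1])⟩
      · rw [ins_of_gt hins W h']; exact lift (s - 2)

/-- **Detecting the first detour.** If `W` agrees with `ω` (all of whose columns up to time `n` are
`≤ R`) below the times of `L`, and `t < n` is smaller than every time of `L` with `ω t` in column `R`,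
then `ins t W` stays in the columns `≤ R` up to time `t` and is in column `R + 1` at time `t + 1`.
[folklore] -/
theorem first_detour {E : Site 2} (hE0 : ∀ x : Site 2, (x + E) 0 = x 0 + 1)
    {ins : ℕ → (ℕ → Site 2) → ℕ → Site 2}
    (hins : ∀ t W s, ins t W s =
      if s ≤ t then W s else if s = t + 1 then W t + E else if s = t + 2 then W (t + 1) + E else W (s - 2))
    {n : ℕ} {R : ℤ} {ω W : ℕ → Site 2} (hR : ∀ i ≤ n, ω i 0 ≤ R) {L : List ℕ} {t : ℕ}
    (hW : ∀ s, (∀ u ∈ L, s ≤ u) → W s = ω s) (hlt : ∀ u ∈ L, t < u) (htn : t < n)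
    (ht0 : ω t 0 = R) :
    (∀ s ≤ t, ins t W s 0 ≤ R) ∧ ins t W (t + 1) 0 = R + 1 := by
  refine ⟨fun s hs => ?_, ?_⟩
  · rw [ins_of_le hins W hs, hW s fun u hu => hs.trans (hlt u hu).le]
    exact hR s (by omega)
  · rw [ins_succ hins, hE0, hW t fun u hu => (hlt u hu).le, ht0]

/-- **Injectivity of the iterated insertion** `(ω, L) ↦ L.foldr ins ω` on pairs (walk with columns
`≤ R`, strictly increasing list of same-parity times of vertical steps in column `R`) with lists of
equal length: the smallest insertion time is the first time after which the walk enters column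
`R + 1`, and a single insertion `W ↦ ins t W` is injective. [folklore] -/
theorem foldr_inj {E : Site 2} (hE : ∀ x : Site 2, (zdGraph 2).Adj x (x + E))
    (hE0 : ∀ x : Site 2, (x + E) 0 = x 0 + 1)
    {ins : ℕ → (ℕ → Site 2) → ℕ → Site 2}
    (hins : ∀ t W s, ins t W s =
      if s ≤ t then W s else if s = t + 1 then W t + E else if s = t + 2 then W (t + 1) + E else W (s - 2))
    {n p : ℕ} {R : ℤ} {ω ω' : ℕ → Site 2} (hω : ω ∈ Zd.saws 2 n) (hR : ∀ i ≤ n, ω i 0 ≤ R)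
    (hω' : ω' ∈ Zd.saws 2 n) (hR' : ∀ i ≤ n, ω' i 0 ≤ R) :
    ∀ L L' : List ℕ, L.Pairwise (· < ·) →
      (∀ t ∈ L, t < n ∧ t % 2 = p ∧ ω t 0 = R ∧ ω (t + 1) 0 = R) →
      L'.Pairwise (· < ·) →
      (∀ t ∈ L', t < n ∧ t % 2 = p ∧ ω' t 0 = R ∧ ω' (t + 1) 0 = R) →
      L.length = L'.length → L.foldr ins ω = L'.foldr ins ω' → ω = ω' ∧ L = L' := by
  intro L
  induction L with
  | nil =>
    intro L' _ _ _ _ hlen heq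
    cases L' with
    | nil => exact ⟨heq, rfl⟩
    | cons _ _ => simp at hlen
  | cons t L ih =>
    intro L' hsort hmem hsort' hmem' hlen heq
    cases L' with
    | nil => simp at hlen
    | cons t' L' =>
      rw [List.pairwise_cons] at hsort hsort'
      simp only [List.foldr_cons] at heq
      have hlen' : L.length = L'.length := by simpa using hlen
      obtain ⟨htn, -, ht0, -⟩ := hmem t List.mem_cons_self
      obtain ⟨htn', -, ht0', -⟩ := hmem' t' List.mem_cons_self
      have hmL : ∀ u ∈ L, u < n ∧ u % 2 = p ∧ ω u 0 = R ∧ ω (u + 1) 0 = R := fun u hu =>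
        hmem u (List.mem_cons_of_mem t hu)
      have hmL' : ∀ u ∈ L', u < n ∧ u % 2 = p ∧ ω' u 0 = R ∧ ω' (u + 1) 0 = R := fun u hu =>
        hmem' u (List.mem_cons_of_mem t' hu)
      obtain ⟨-, hW2, -⟩ := foldr_spec hE hE0 hins hω hR L hsort.2 hmL
      obtain ⟨-, hW2', -⟩ := foldr_spec hE hE0 hins hω' hR' L' hsort'.2 hmL'
      obtain ⟨ha, hb⟩ := first_detour hE0 hins hR hW2 hsort.1 htn ht0
      obtain ⟨ha', hb'⟩ := first_detour hE0 hins hR' hW2' hsort'.1 htn' ht0'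
      have htt : t = t' := by
        by_contra hne
        rcases Nat.lt_or_gt_of_ne hne with h | h
        · have h1 := ha' (t + 1) h
          rw [← heq, hb] at h1
          omega
        · have h1 := ha (t' + 1) h
          rw [heq, hb'] at h1
          omega
      rw [← htt] at heq hsort'
      have hWW : L.foldr ins ω = L'.foldr ins ω' := by
        funext s
        rcases le_or_gt s t with hs | hs
        · have := congrFun heq s
          rwa [ins_of_le hins _ hs, ins_of_le hins _ hs] at this
        · have := congrFun heq (s + 2)
          rwa [ins_of_gt hins _ (show t + 2 < s + 2 by omega),
            ins_of_gt hins _ (show t + 2 < s + 2 by omega), Nat.add_sub_cancel] at this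
      obtain ⟨h1, h2⟩ := ih L' hsort.2 hmL hsort'.2 hmL' hlen' hWW
      exact ⟨h1, by rw [h2, htt]⟩

/-! ## The counting bound -/

/-- **Boundary-detour injection** (strip-gap programme, T1). For `n m j p : ℕ` and a column `R`,
the `n`-step self-avoiding walks on `ℤ²` all of whose columns are `≤ R` and which make at least `m`
vertical steps of time-parity `p` inside the column `R`, counted with multiplicity `m choose j`, are at
most `c_{n+2j}`: choosing `j` of these steps and inserting at each the detour through the free column
`R + 1` produces distinct `(n+2j)`-step self-avoiding walks. [folklore] -/
theorem detour_count :
    ∀ (n m j p : ℕ) (R : ℤ),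
      ((Zd.saws 2 n).filter (fun ω => (∀ i ≤ n, ω i 0 ≤ R) ∧
        m ≤ ((Finset.range n).filter (fun t => t % 2 = p ∧ ω t 0 = R ∧ ω (t + 1) 0 = R)).card)).card
        * m.choose j ≤ Zd.count 2 (n + 2 * j) := by
  intro n m j p R
  -- the unit vector `e₀` and the detour insertion
  obtain ⟨E, hE, hE0⟩ : ∃ E : Site 2, (∀ x : Site 2, (zdGraph 2).Adj x (x + E)) ∧
      ∀ x : Site 2, (x + E) 0 = x 0 + 1 :=
    ⟨Pi.single 0 1, fun x => (zdGraph_adj_iff _ _).2 ⟨0, Or.inl rfl⟩, fun x => by simp⟩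
  obtain ⟨ins, hins⟩ : ∃ ins : ℕ → (ℕ → Site 2) → ℕ → Site 2, ∀ t W s, ins t W s =
      if s ≤ t then W s else if s = t + 1 then W t + E
        else if s = t + 2 then W (t + 1) + E else W (s - 2) :=
    ⟨fun t W s => if s ≤ t then W s else if s = t + 1 then W t + E
        else if s = t + 2 then W (t + 1) + E else W (s - 2), fun _ _ _ => rfl⟩
  set A := (Zd.saws 2 n).filter (fun ω => (∀ i ≤ n, ω i 0 ≤ R) ∧
    m ≤ ((Finset.range n).filter (fun t => t % 2 = p ∧ ω t 0 = R ∧ ω (t + 1) 0 = R)).card) with hA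
  -- membership in the set of pairs `(ω, T)`, `T` a `j`-subset of the vertical steps of `ω` in column `R`
  have hmemD : ∀ x ∈ A.sigma (fun ω => ((Finset.range n).filter
      (fun t => t % 2 = p ∧ ω t 0 = R ∧ ω (t + 1) 0 = R)).powersetCard j),
      x.1 ∈ Zd.saws 2 n ∧ (∀ i ≤ n, x.1 i 0 ≤ R) ∧ (x.2.sort).Pairwise (· < ·) ∧
      (∀ t ∈ x.2.sort, t < n ∧ t % 2 = p ∧ x.1 t 0 = R ∧ x.1 (t + 1) 0 = R) ∧
      (x.2.sort).length = j := by
    intro x hx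
    simp only [hA, Finset.mem_sigma, Finset.mem_filter, Finset.mem_powersetCard] at hx
    obtain ⟨⟨hω, hR, -⟩, hsub, hcard⟩ := hx
    refine ⟨hω, hR, List.sortedLT_iff_pairwise.1 (Finset.sortedLT_sort _), fun t ht => ?_,
      by rw [Finset.length_sort, hcard]⟩
    have := hsub ((Finset.mem_sort _).1 ht)
    rw [Finset.mem_filter, Finset.mem_range] at this
    exact this
  calc A.card * m.choose j = ∑ _ω ∈ A, m.choose j := by rw [Finset.sum_const, smul_eq_mul]
    _ ≤ ∑ ω ∈ A, (((Finset.range n).filter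
          (fun t => t % 2 = p ∧ ω t 0 = R ∧ ω (t + 1) 0 = R)).powersetCard j).card :=
        Finset.sum_le_sum fun ω hω => by
          rw [Finset.card_powersetCard]
          exact Nat.choose_le_choose j (Finset.mem_filter.1 hω).2.2
    _ = (A.sigma (fun ω => ((Finset.range n).filter
          (fun t => t % 2 = p ∧ ω t 0 = R ∧ ω (t + 1) 0 = R)).powersetCard j)).card :=
        (Finset.card_sigma _ _).symm
    _ ≤ (Zd.saws 2 (n + 2 * j)).card := by
        refine Finset.card_le_card_of_injOn
          (fun x : (Σ _ : ℕ → Site 2, Finset ℕ) => (x.2.sort).foldr ins x.1) ?_ ?_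
        · intro x hx
          obtain ⟨hω, hR, hsort, hmem, hlen⟩ := hmemD x (Finset.mem_coe.1 hx)
          have := (foldr_spec hE hE0 hins hω hR _ hsort hmem).1
          rw [hlen] at this
          exact Finset.mem_coe.2 this
        · intro x hx y hy hxy
          obtain ⟨hω, hR, hsort, hmem, hlen⟩ := hmemD x (Finset.mem_coe.1 hx)
          obtain ⟨hω', hR', hsort', hmem', hlen'⟩ := hmemD y (Finset.mem_coe.1 hy)
          obtain ⟨h1, h2⟩ := foldr_inj hE hE0 hins hω hR hω' hR' _ _ hsort hmem hsort' hmem'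
            (hlen.trans hlen'.symm) hxy
          have h3 : x.2 = y.2 :=
            calc x.2 = (x.2.sort).toFinset := (Finset.sort_toFinset _ _).symm
              _ = y.2 := by rw [h2, Finset.sort_toFinset]
          exact Sigma.ext h1 (heq_of_eq h3)
    _ = Zd.count 2 (n + 2 * j) := Zd.card_saws 2 _

end Summit.CriticalPhenomena.SAWScalingLimit.Theorems.CriticalBubbleBound.Kesten.Strip

end
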